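import Summits.Ventures.PercRepro.ProfilePointedCircuitClassesThreeCocircuitA

/-!
# PercRepro — A POINT OF A 3-COCIRCUIT, PART B: THE TWELVE-POINT STATEMENT REDUCES TO THE `n = 10` THEOREM AND TO
THE PER-POINT FORM OF THEOREM A AT `n = 10` (p5, gen 48; `proofs/P5-GM1.md` §72)

On `#E = 12`, `ρ(E) = 7`, let `{e, p, q}` be a cocircuit (no two of the three a cocircuit).  A demand `W ∈ BI_5`
through `e` contains at most one of `p, q`; the units `S ∈ BI_6` avoiding `e` split by `S ∩ {p, q}`.  Writing
`N₁ := N ／ e ∖ q`, `N₂ := N ／ p ∖ e` (ten points, rank 6), part A gives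
`#{W ∋ e, p} ≤ in_4^{N₁}(p)`, `out_5^{N₁}(p) ≤ #{S ∌ e, p : q ∈ S}` (symmetrically with `p, q` swapped),
`#{W ∋ e : p, q ∉ W} ≤ out_4^{N₂}(q)` and `in_5^{N₂}(q) ≤ #{S ∌ e : p, q ∈ S}`; with the `n = 10` theorem (§59)
for `N₁` and its twin, the twelve-point statement at `e` follows from `out_4(q) ≤ in_5(q)` on `N₂` — an instance of
the per-point form of Theorem A at `n = 10` (the cell's `BiIndepPointed`, census-true, not proved).
`inCount_five_le_outCount_six_of_threeCocircuit` takes that one instance as a hypothesis;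
`inCount_five_le_outCount_six_of_threeCocircuit_of_pointed` takes `BiIndepPointed α`.
-/

open scoped Matroid

namespace PercRepro.Cogirth

open Finset ThmH Skew Shadow Profile

variable {α : Type} [DecidableEq α] {N : Matroid α} [N.Finite]

section ThreeCocircuitB

/-- **A POINT OF A 3-COCIRCUIT — THE REDUCTION**: `#E = 12`, `ρ(E) = 7`, `{e, p, q}` a cocircuit with
`ρ(E − {e, p}) = ρ(E − {e, q}) = ρ(E − {p, q}) = 7`, and `out_4(q) ≤ in_5(q)` on the ten-point minor `N ／ p ∖ e` (one
instance of the per-point form of Theorem A at `n = 10`): then `in_5(e) ≤ out_6(e)`.  The demands through `e` split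
by their trace on `{p, q}` into `W ∋ e, p` (injected into `BI_4(N ／ e ∖ q)` at `p`), `W ∋ e, q` (into
`BI_4(N ／ e ∖ p)` at `q`) and `W ∌ p, q` (into the out-sets of `N ／ p ∖ e` at `q`); the `n = 10` theorem and the
hypothesis carry each class into the corresponding class of units avoiding `e`, which are disjoint. -/
theorem inCount_five_le_outCount_six_of_threeCocircuit (hn : (gr N).card = 12) (hR : rk N (gr N) = 7) {e p q : α}
    (he : e ∈ gr N) (hp : p ∈ gr N) (hq : q ∈ gr N) (hep : e ≠ p) (heq : e ≠ q) (hpq : p ≠ q)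
    (hcoc : rk N ((((gr N).erase e).erase p).erase q) = 6) (hc1 : rk N (((gr N).erase e).erase p) = 7)
    (hc2 : rk N (((gr N).erase e).erase q) = 7) (hc3 : rk N (((gr N).erase p).erase q) = 7)
    (hpt : outCount ((N ／ ({p} : Set α)) ＼ ({e} : Set α)) 4 q ≤
      inCount ((N ／ ({p} : Set α)) ＼ ({e} : Set α)) 5 q) :
    inCount N 5 e ≤ outCount N 6 e := by
  have hH : ∀ X ⊆ (((gr N).erase e).erase p).erase q,
      rk N (insert e X) = rk N X + 1 ∧ rk N (insert p X) = rk N X + 1 ∧ rk N (insert q X) = rk N X + 1 :=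
    fun X hX => hyperplane_facts_of_threeCocircuit he hp hq hep heq hpq hcoc hc1 hc2 hc3 hX
  have hcoc' : rk N ((((gr N).erase e).erase q).erase p) = 6 := by rw [erase_right_comm]; exact hcoc
  have hH' : ∀ X ⊆ (((gr N).erase e).erase q).erase p,
      rk N (insert e X) = rk N X + 1 ∧ rk N (insert q X) = rk N X + 1 ∧ rk N (insert p X) = rk N X + 1 := by
    intro X hX
    rw [erase_right_comm] at hX
    obtain ⟨h1, h2, h3⟩ := hH X hX
    exact ⟨h1, h3, h2⟩
  have hre : rk N {e} = 1 := by
    have := (hH ∅ (empty_subset _)).1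
    rw [insert_empty, rk_empty_eq_zero] at this
    exact this
  -- neither `p` nor `q` is a coloop
  have hcp : rk N ((gr N).erase p) = 7 := by
    have h1 := rk_mono' (M := N) (show ((gr N).erase e).erase p ⊆ (gr N).erase p from by
      rw [erase_right_comm]; exact erase_subset _ _)
    have h2 := rk_mono' (M := N) (erase_subset p (gr N))
    rw [hc1] at h1
    rw [hR] at h2
    omega
  have hcq : rk N ((gr N).erase q) = 7 := by
    have h1 := rk_mono' (M := N) (show ((gr N).erase e).erase q ⊆ (gr N).erase q from by
      rw [erase_right_comm]; exact erase_subset _ _)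
    have h2 := rk_mono' (M := N) (erase_subset q (gr N))
    rw [hc2] at h1
    rw [hR] at h2
    omega
  -- the ten-point minors `N ／ e ∖ q` (at `p`) and `N ／ e ∖ p` (at `q`)
  have hgr1 := gr_minor_eq (N := N) e q
  have hgr2 := gr_minor_eq (N := N) e p
  have hcard1 : (gr ((N ／ ({e} : Set α)) ＼ ({q} : Set α))).card = 10 := by
    rw [hgr1, card_erase_of_mem (mem_erase.2 ⟨heq.symm, hq⟩), card_erase_of_mem he, hn]
  have hcard2 : (gr ((N ／ ({e} : Set α)) ＼ ({p} : Set α))).card = 10 := by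
    rw [hgr2, card_erase_of_mem (mem_erase.2 ⟨hep.symm, hp⟩), card_erase_of_mem he, hn]
  have hrk1 : rk ((N ／ ({e} : Set α)) ＼ ({q} : Set α)) (gr ((N ／ ({e} : Set α)) ＼ ({q} : Set α))) = 6 := by
    have h1 := rk_minor_add_one hre (Finset.Subset.refl (gr ((N ／ ({e} : Set α)) ＼ ({q} : Set α))))
    have h2 : rk N (insert e (gr ((N ／ ({e} : Set α)) ＼ ({q} : Set α)))) = 7 := by
      rw [hgr1, erase_right_comm, insert_erase (mem_erase.2 ⟨heq, he⟩)]
      exact hcq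
    omega
  have hrk2 : rk ((N ／ ({e} : Set α)) ＼ ({p} : Set α)) (gr ((N ／ ({e} : Set α)) ＼ ({p} : Set α))) = 6 := by
    have h1 := rk_minor_add_one hre (Finset.Subset.refl (gr ((N ／ ({e} : Set α)) ＼ ({p} : Set α))))
    have h2 : rk N (insert e (gr ((N ／ ({e} : Set α)) ＼ ({p} : Set α)))) = 7 := by
      rw [hgr2, erase_right_comm, insert_erase (mem_erase.2 ⟨hep, he⟩)]
      exact hcp
    omega
  have hp1 : p ∈ gr ((N ／ ({e} : Set α)) ＼ ({q} : Set α)) := by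
    rw [hgr1]; exact mem_erase.2 ⟨hpq, mem_erase.2 ⟨hep.symm, hp⟩⟩
  have hq2 : q ∈ gr ((N ／ ({e} : Set α)) ＼ ({p} : Set α)) := by
    rw [hgr2]; exact mem_erase.2 ⟨hpq.symm, mem_erase.2 ⟨heq.symm, hq⟩⟩
  have hT1 := inCount_four_le_outCount_five_of_card_ten (by omega) hrk1 hp1
  have hT2 := inCount_four_le_outCount_five_of_card_ten (by omega) hrk2 hq2
  -- the six injections
  have hA1 := card_filter_demands_le_inCount_minor hn hq hep hH hcoc
  have hA2 := card_filter_demands_le_inCount_minor hn hp heq hH' hcoc'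
  have hA3 := card_filter_demands_free_le_outCount_minor hn hp hH
  have hB1 := outCount_minor_le_card_filter_units hn he hq heq hpq hH
  have hB2 := outCount_minor_le_card_filter_units hn he hp hep hpq.symm hH'
  have hB3 := inCount_minor_le_card_filter_units_both hn he hp hep hH
  -- the demands through `e` are covered by the three classes
  have hD : ((biIndepSets N 5).filter (fun W => e ∈ W)).card ≤
      ((biIndepSets N 5).filter (fun W => e ∈ W ∧ p ∈ W)).card +
        ((biIndepSets N 5).filter (fun W => e ∈ W ∧ q ∈ W)).card +
        ((biIndepSets N 5).filter (fun W => e ∈ W ∧ p ∉ W ∧ q ∉ W)).card := by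
    refine le_trans (card_le_card ?_) (le_trans (card_union_le _ _) (Nat.add_le_add_right (card_union_le _ _) _))
    intro W hW
    rw [mem_filter] at hW
    rw [mem_union, mem_union, mem_filter, mem_filter, mem_filter]
    by_cases hpW : p ∈ W
    · exact Or.inl (Or.inl ⟨hW.1, hW.2, hpW⟩)
    by_cases hqW : q ∈ W
    · exact Or.inl (Or.inr ⟨hW.1, hW.2, hqW⟩)
    exact Or.inr ⟨hW.1, hW.2, hpW, hqW⟩
  -- the three classes of units avoiding `e` are disjoint
  have hU : ((biIndepSets N 6).filter (fun S => (e ∉ S ∧ q ∈ S) ∧ p ∉ S)).card +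
        ((biIndepSets N 6).filter (fun S => (e ∉ S ∧ p ∈ S) ∧ q ∉ S)).card +
        ((biIndepSets N 6).filter (fun S => (e ∉ S ∧ p ∈ S) ∧ q ∈ S)).card ≤
      ((biIndepSets N 6).filter (fun S => e ∉ S)).card := by
    have hd1 : Disjoint ((biIndepSets N 6).filter (fun S => (e ∉ S ∧ q ∈ S) ∧ p ∉ S))
        ((biIndepSets N 6).filter (fun S => (e ∉ S ∧ p ∈ S) ∧ q ∉ S)) := by
      rw [disjoint_left]
      intro S h1 h2
      rw [mem_filter] at h1 h2
      exact h1.2.2 h2.2.1.2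
    have hd2 : Disjoint ((biIndepSets N 6).filter (fun S => (e ∉ S ∧ q ∈ S) ∧ p ∉ S) ∪
          (biIndepSets N 6).filter (fun S => (e ∉ S ∧ p ∈ S) ∧ q ∉ S))
        ((biIndepSets N 6).filter (fun S => (e ∉ S ∧ p ∈ S) ∧ q ∈ S)) := by
      rw [disjoint_left]
      intro S h1 h2
      rw [mem_union, mem_filter, mem_filter] at h1
      rw [mem_filter] at h2
      rcases h1 with h1 | h1
      · exact h1.2.2 h2.2.1.2
      · exact h1.2.2 h2.2.2
    rw [← card_union_of_disjoint hd1, ← card_union_of_disjoint hd2]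
    apply card_le_card
    intro S hS
    rw [mem_union, mem_union, mem_filter, mem_filter, mem_filter] at hS
    rw [mem_filter]
    rcases hS with (hS | hS) | hS
    · exact ⟨hS.1, hS.2.1.1⟩
    · exact ⟨hS.1, hS.2.1.1⟩
    · exact ⟨hS.1, hS.2.1.1⟩
  unfold inCount outCount
  omega

/-- **A POINT OF A 3-COCIRCUIT, FROM THE PER-POINT FORM OF THEOREM A**: under `BiIndepPointed α` the hypothesis
`hpt` of `inCount_five_le_outCount_six_of_threeCocircuit` holds (on the ten-point minor `N ／ p ∖ e`, `k = 4`). -/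
theorem inCount_five_le_outCount_six_of_threeCocircuit_of_pointed (hpt : BiIndepPointed α) (hn : (gr N).card = 12)
    (hR : rk N (gr N) = 7) {e p q : α} (he : e ∈ gr N) (hp : p ∈ gr N) (hq : q ∈ gr N) (hep : e ≠ p) (heq : e ≠ q)
    (hpq : p ≠ q) (hcoc : rk N ((((gr N).erase e).erase p).erase q) = 6)
    (hc1 : rk N (((gr N).erase e).erase p) = 7) (hc2 : rk N (((gr N).erase e).erase q) = 7)
    (hc3 : rk N (((gr N).erase p).erase q) = 7) : inCount N 5 e ≤ outCount N 6 e := by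
  apply inCount_five_le_outCount_six_of_threeCocircuit hn hR he hp hq hep heq hpq hcoc hc1 hc2 hc3
  have hgr := gr_minor_eq (N := N) p e
  have hq2 : q ∈ gr ((N ／ ({p} : Set α)) ＼ ({e} : Set α)) := by
    rw [hgr]; exact mem_erase.2 ⟨heq.symm, mem_erase.2 ⟨hpq.symm, hq⟩⟩
  have hcard : (gr ((N ／ ({p} : Set α)) ＼ ({e} : Set α))).card = 10 := by
    rw [hgr, card_erase_of_mem (mem_erase.2 ⟨hep, he⟩), card_erase_of_mem hp, hn]
  exact hpt _ q 4 hq2 (by omega)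

end ThreeCocircuitB

end PercRepro.Cogirth
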